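import Literature.Analysis.Hypoelliptic.SymCalculus
import HarnessLib

/-!
# Fourier-side vector fields as symbolic operators: brackets, adjoints and divergence

Analysis/Hypoelliptic support file, eighth piece of the Fourier-side toolkit serving the
discharge of `Literature.Analysis.Distribution.Hormander1967_thm11` by Kohn's method
(M. Taylor, *Pseudodifferential Operators* (1981), Ch. XV §1). Continues `SymCalculus.lean`.

A vector field `X = ∑_k a_k(x) ∂_{v_k}` with coefficients `a_k = c_k + b_k`, `b_k ∈ 𝓢`, is, on
the Fourier side, the symbolic operator `∑_k A_k ∘ lin v_k` with coefficient expressions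
`A_k` (`Field V = List (Sym V × V)`, `Field.toSym`). PROVED here:

* finite sums of expressions (`Sym.sum`) and their algebra up to `≈`;
* **the bracket**: `[X, Y] ≈ Field.bracket X Y`, again a field, with coefficients
  `A_k (∂_{v_k} B_l)` and `-B_l (∂_{w_l} A_k)` (`Field.comm_toSym`);
* **the adjoint**: `X† ≈ -(X‡ + div X‡)` where `X‡` has the adjoint coefficients and
  `div X = ∑_k ∂_{v_k} A_k` (`Field.adj_toSym`); for REAL fields (`Field.IsReal`:
  self-adjoint coefficients) `X† ≈ -X - div X` — the integration-by-parts formula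
  `X* = -X - div X` on the Fourier side.

## References

* M. E. Taylor, *Pseudodifferential Operators* (1981), Ch. XV §1; Hörmander 1967, §3 (p. 152:
  the adjoint of `X_j` is `-X_j + a_j`).
-/

noncomputable section

open MeasureTheory Set Filter Function
open scoped ENNReal NNReal Topology ComplexConjugate InnerProductSpace

namespace Literature.Analysis.Hypoelliptic

variable {V : Type*} [NormedAddCommGroup V] [InnerProductSpace ℝ V] [FiniteDimensional ℝ V]
  [MeasurableSpace V] [BorelSpace V]

namespace Sym

/-! ### Algebra of finite sums up to `≈` -/

/-- `sum (l₁ ++ l₂) ≈ sum l₁ + sum l₂`. [folklore] -/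
theorem sum_append (l₁ l₂ : List (Sym V)) : sum (l₁ ++ l₂) ≈ add (sum l₁) (sum l₂) := by
  induction l₁ with
  | nil => exact (zero_add' _).symm
  | cons s l ih =>
    rw [List.cons_append]
    exact (sum_cons s _).trans (((Equiv.refl s).add ih).trans
      ((add_assoc' _ _ _).symm.trans ((sum_cons s l).symm.add Equiv.rfl)))

/-- Termwise equivalent lists have equivalent sums. [folklore] -/
theorem sum_map_equiv {α : Type*} {l : List α} {f g : α → Sym V} (h : ∀ x ∈ l, f x ≈ g x) :
    sum (l.map f) ≈ sum (l.map g) := by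
  induction l with
  | nil => exact Equiv.rfl
  | cons x l ih =>
    simp only [List.map_cons]
    exact (sum_cons _ _).trans (((h x List.mem_cons_self).add
      (ih fun y hy => h y (List.mem_cons_of_mem _ hy))).trans (sum_cons _ _).symm)

/-- `sum` of a `flatMap`. [folklore] -/
theorem sum_flatMap {α : Type*} (l : List α) (f : α → List (Sym V)) :
    sum (l.flatMap f) ≈ sum (l.map fun x => sum (f x)) := by
  induction l with
  | nil => exact Equiv.rfl
  | cons x l ih =>
    rw [List.flatMap_cons, List.map_cons]
    exact (sum_append _ _).trans ((Equiv.rfl.add ih).trans (sum_cons _ _).symm)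

/-- `sum` of termwise sums. [folklore] -/
theorem sum_map_add {α : Type*} (l : List α) (f g : α → Sym V) :
    sum (l.map fun x => add (f x) (g x)) ≈ add (sum (l.map f)) (sum (l.map g)) := by
  induction l with
  | nil => exact (add_zero' _).symm
  | cons x l ih =>
    simp only [List.map_cons]
    refine (sum_cons _ _).trans ((Equiv.rfl.add ih).trans ?_)
    refine Equiv.trans ?_ ((sum_cons _ _).symm.add (sum_cons _ _).symm)
    intro F _; ext ξ; simp only [apply_add]; ring

/-- `sum` of termwise negations. [folklore] -/
theorem sum_map_neg {α : Type*} (l : List α) (f : α → Sym V) :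
    sum (l.map fun x => neg (f x)) ≈ neg (sum (l.map f)) := by
  induction l with
  | nil => intro F _; ext ξ; simp
  | cons x l ih =>
    simp only [List.map_cons]
    refine (sum_cons _ _).trans ((Equiv.rfl.add ih).trans ?_)
    refine Equiv.trans ?_ (sum_cons _ _).symm.neg
    intro F _; ext ξ; simp only [apply_add, apply_neg]; ring

/-- `sum` of termwise scalar multiples. [folklore] -/
theorem sum_map_smul {α : Type*} (c : ℂ) (l : List α) (f : α → Sym V) :
    sum (l.map fun x => smul c (f x)) ≈ smul c (sum (l.map f)) := by
  induction l with
  | nil => intro F _; ext ξ; simp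
  | cons x l ih =>
    simp only [List.map_cons]
    refine (sum_cons _ _).trans ((Equiv.rfl.add ih).trans ?_)
    refine Equiv.trans ?_ ((sum_cons _ _).symm.smul c)
    intro F _; ext ξ; simp only [apply_add, apply_smul]; ring

/-- A two-element sum is definitional. [folklore] -/
theorem sum_pair (s t : Sym V) : sum [s, t] ≈ add s t := Equiv.rfl

/-- Composition distributes over `sum` on the right factor. [folklore] -/
theorem sum_comp_right : ∀ (l : List (Sym V)) (t : Sym V),
    comp (sum l) t ≈ sum (l.map fun s => comp s t)
  | [], t => zero_comp' t
  | [_], _ => Equiv.rfl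
  | s :: u :: l, t => by
    rw [List.map_cons, List.map_cons, sum_cons_cons, sum_cons_cons]
    have ih := sum_comp_right (u :: l) t
    rw [List.map_cons] at ih
    exact (comp_add_right s _ t).trans (Equiv.rfl.add ih)

/-- Composition distributes over `sum` on the left factor (needs linearity). [folklore] -/
theorem sum_comp_left {s : Sym V} (hs : Cert s) {l : List (Sym V)} (hl : ∀ t ∈ l, Cert t) :
    comp s (sum l) ≈ sum (l.map fun t => comp s t) := by
  induction l with
  | nil => exact comp_zero' s
  | cons t l ih =>
    simp only [List.map_cons]
    have hl' : ∀ u ∈ l, Cert u := fun u hu => hl u (List.mem_cons_of_mem _ hu)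
    refine ((sum_cons t l).comp_right s).trans ?_
    exact (comp_add_left hs (hl t List.mem_cons_self) (cert_sum hl')).trans
      ((Equiv.rfl.add (ih hl')).trans (sum_cons _ _).symm)

/-- The commutator distributes over `sum` in the left slot. [folklore] -/
theorem comm_sum_left {l : List (Sym V)} (hl : ∀ s ∈ l, Cert s) {t : Sym V} (ht : Cert t) :
    comm (sum l) t ≈ sum (l.map fun s => comm s t) := by
  induction l with
  | nil => exact comm_cmul_left 0 t
  | cons s l ih =>
    simp only [List.map_cons]
    have hl' : ∀ u ∈ l, Cert u := fun u hu => hl u (List.mem_cons_of_mem _ hu)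
    refine ((sum_cons s l).comm Equiv.rfl (cert_sum hl) ht).trans ?_
    exact (comm_add_left (hl s List.mem_cons_self) (cert_sum hl') ht).trans
      ((Equiv.rfl.add (ih hl')).trans (sum_cons _ _).symm)

/-- The commutator distributes over `sum` in the right slot. [folklore] -/
theorem comm_sum_right {s : Sym V} (hs : Cert s) {l : List (Sym V)} (hl : ∀ t ∈ l, Cert t) :
    comm s (sum l) ≈ sum (l.map fun t => comm s t) := by
  induction l with
  | nil => exact comm_cmul_right s 0
  | cons t l ih =>
    simp only [List.map_cons]
    have hl' : ∀ u ∈ l, Cert u := fun u hu => hl u (List.mem_cons_of_mem _ hu)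
    refine (Equiv.rfl.comm (sum_cons t l) hs (cert_sum hl)).trans ?_
    exact (comm_add_right hs (hl t List.mem_cons_self) (cert_sum hl')).trans
      ((Equiv.rfl.add (ih hl')).trans (sum_cons _ _).symm)

end Sym

/-! ### Fields -/

variable (V) in
/-- **A Fourier-side vector field**: a list of pairs (coefficient expression, direction),
standing for `∑_k A_k ∘ lin v_k` (`X = ∑_k a_k(x) ∂_{v_k}`). [folklore] -/
abbrev Field := List (Sym V × V)

namespace Field

open Sym

/-- The symbolic operator of a field. [folklore] -/
def toSym (X : Field V) : Sym V :=
  Sym.sum (X.map fun p => comp p.1 (lin p.2))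

/-- All coefficients are coefficient expressions. [folklore] -/
def IsField (X : Field V) : Prop := ∀ p ∈ X, IsCoef p.1

/-- All coefficients are certified. [folklore] -/
def CertF (X : Field V) : Prop := ∀ p ∈ X, Cert p.1

omit [InnerProductSpace ℝ V] [FiniteDimensional ℝ V] [MeasurableSpace V] [BorelSpace V] [NormedAddCommGroup V] in
/-- (structural lemma) [folklore] -/
@[simp] theorem toSym_nil : toSym ([] : Field V) = Sym.zero := rfl
/-- (structural lemma) [folklore] -/
theorem toSym_cons (p : Sym V × V) (X : Field V) :
    toSym (p :: X) ≈ add (comp p.1 (lin p.2)) (toSym X) := by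
  unfold toSym; rw [List.map_cons]; exact Sym.sum_cons _ _

omit [NormedAddCommGroup V] [InnerProductSpace ℝ V] [FiniteDimensional ℝ V] [MeasurableSpace V] [BorelSpace V] in
/-- (structural lemma) [folklore] -/
theorem IsField.nil : IsField ([] : Field V) := fun _ h => by simp at h
omit [InnerProductSpace ℝ V] [FiniteDimensional ℝ V] [BorelSpace V] in
/-- (structural lemma) [folklore] -/
theorem CertF.nil : CertF ([] : Field V) := fun _ h => by simp at h
omit [NormedAddCommGroup V] [InnerProductSpace ℝ V] [FiniteDimensional ℝ V] [MeasurableSpace V] [BorelSpace V] in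
/-- (structural lemma) [folklore] -/
theorem IsField.cons {p : Sym V × V} {X : Field V} (hp : IsCoef p.1) (hX : IsField X) :
    IsField (p :: X) := fun q hq => by
  rcases List.mem_cons.1 hq with rfl | hq
  exacts [hp, hX q hq]
omit [InnerProductSpace ℝ V] [FiniteDimensional ℝ V] [BorelSpace V] in
/-- (structural lemma) [folklore] -/
theorem CertF.cons {p : Sym V × V} {X : Field V} (hp : Cert p.1) (hX : CertF X) :
    CertF (p :: X) := fun q hq => by
  rcases List.mem_cons.1 hq with rfl | hq
  exacts [hp, hX q hq]
omit [NormedAddCommGroup V] [InnerProductSpace ℝ V] [FiniteDimensional ℝ V] [MeasurableSpace V] [BorelSpace V] in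
/-- (structural lemma) [folklore] -/
theorem IsField.append {X Y : Field V} (hX : IsField X) (hY : IsField Y) : IsField (X ++ Y) :=
  fun p hp => (List.mem_append.1 hp).elim (hX p) (hY p)
omit [InnerProductSpace ℝ V] [FiniteDimensional ℝ V] [BorelSpace V] in
/-- (structural lemma) [folklore] -/
theorem CertF.append {X Y : Field V} (hX : CertF X) (hY : CertF Y) : CertF (X ++ Y) :=
  fun p hp => (List.mem_append.1 hp).elim (hX p) (hY p)

omit [InnerProductSpace ℝ V] [FiniteDimensional ℝ V] [BorelSpace V] in
/-- The symbolic operator of a certified field is certified. [folklore] -/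
theorem CertF.cert_toSym {X : Field V} (h : CertF X) : Cert (toSym X) :=
  cert_sum fun s hs => by
    obtain ⟨p, hp, rfl⟩ := List.mem_map.1 hs
    exact ⟨h p hp, trivial⟩

omit [NormedAddCommGroup V] [InnerProductSpace ℝ V] [FiniteDimensional ℝ V] [MeasurableSpace V] [BorelSpace V] in
/-- The symbolic operator of a field is plain. [folklore] -/
theorem IsField.plain_toSym {X : Field V} (h : IsField X) : Plain (toSym X) :=
  plain_sum fun s hs => by
    obtain ⟨p, hp, rfl⟩ := List.mem_map.1 hs
    exact ⟨(h p hp).plain, trivial⟩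

omit [NormedAddCommGroup V] [InnerProductSpace ℝ V] [FiniteDimensional ℝ V] [MeasurableSpace V] [BorelSpace V] in
/-- A field has order `≤ 1`. [folklore] -/
theorem IsField.ord_toSym_le {X : Field V} (h : IsField X) : ord (toSym X) ≤ 1 := by
  rcases X with _ | ⟨p, X⟩
  · simp [toSym]
  · refine Sym.ord_sum_le (by simp) fun s hs => ?_
    obtain ⟨q, hq, rfl⟩ := List.mem_map.1 hs
    simp [(h q hq).ord_eq]

/-! ### The bracket of two fields -/

/-- **The bracket** `[X, Y]` of two fields: for `X = ∑_k A_k lin v_k`, `Y = ∑_l B_l lin w_l`,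
the field with the terms `A_k (∂_{v_k} B_l) lin w_l` and `-B_l (∂_{w_l} A_k) lin v_k`.
[folklore] -/
def bracket (X Y : Field V) : Field V :=
  X.flatMap fun p => Y.flatMap fun q =>
    [(comp p.1 (lcomm p.2 q.1), q.2), (neg (comp q.1 (lcomm q.2 p.1)), p.2)]

omit [FiniteDimensional ℝ V] [MeasurableSpace V] [BorelSpace V] in
/-- The bracket of fields is a field. [folklore] -/
theorem IsField.bracket {X Y : Field V} (hX : IsField X) (hY : IsField Y) :
    IsField (bracket X Y) := by
  intro r hr
  simp only [Field.bracket, List.mem_flatMap, List.mem_cons, List.mem_nil_iff, or_false] at hr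
  obtain ⟨p, hp, q, hq, rfl | rfl⟩ := hr
  · exact ⟨hX p hp, (hY q hq).lcomm_isCoef _⟩
  · exact ⟨hY q hq, (hX p hp).lcomm_isCoef _⟩

omit [FiniteDimensional ℝ V] in
/-- The bracket of certified fields is certified. [folklore] -/
theorem CertF.bracket {X Y : Field V} (hX : IsField X) (hcX : CertF X) (hY : IsField Y)
    (hcY : CertF Y) : CertF (bracket X Y) := by
  intro r hr
  simp only [Field.bracket, List.mem_flatMap, List.mem_cons, List.mem_nil_iff, or_false] at hr
  obtain ⟨p, hp, q, hq, rfl | rfl⟩ := hr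
  · exact ⟨hcX p hp, (hcY q hq).lcomm_cert _ (hY q hq)⟩
  · exact ⟨hcY q hq, (hcX p hp).lcomm_cert _ (hX p hp)⟩

/-- The bracket of two elementary fields `A lin v`, `B lin w`. [folklore] -/
theorem comm_single {A B : Sym V} (hA : IsCoef A) (hcA : Cert A) (hB : IsCoef B) (hcB : Cert B)
    (v w : V) :
    comm (comp A (lin v)) (comp B (lin w)) ≈
      add (comp (comp A (lcomm v B)) (lin w)) (comp (neg (comp B (lcomm w A))) (lin v)) := by
  have hcAv : Cert (comp A (lin v)) := ⟨hcA, trivial⟩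
  have hcBw : Cert (comp B (lin w)) := ⟨hcB, trivial⟩
  -- `[A lin v, B lin w] = A [lin v, B lin w] + [A, B lin w] lin v`
  refine (comp_comm hcA (cert_lin v) hcBw).trans ?_
  -- first summand: `[lin v, B lin w] = [lin v, B] lin w + B [lin v, lin w] ≈ (lcomm v B) lin w`
  have h1 : Sym.comm (lin v) (comp B (lin w)) ≈ comp (lcomm v B) (lin w) := by
    refine (comm_comp (cert_lin v) hcB (cert_lin w)).trans ?_
    refine (((hB.comm_lin v hcB).comp_left (cert_lin w)).add
      (((isMul_lin v).comm_equiv_zero (isMul_lin w)).comp_right B)).trans ?_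
    exact (Sym.Equiv.rfl.add (comp_zero' B)).trans (add_zero' _)
  -- second summand: `[A, B lin w] = [A, B] lin w + B [A, lin w] ≈ B (-(lcomm w A))`
  have h2 : Sym.comm A (comp B (lin w)) ≈ comp B (neg (lcomm w A)) := by
    refine (comm_comp hcA hcB (cert_lin w)).trans ?_
    refine (((hA.comm_coef hcA hB hcB).comp_left (cert_lin w)).add
      ((hA.comm_lin_right w hcA).comp_right B)).trans ?_
    exact ((zero_comp' _).add Sym.Equiv.rfl).trans (zero_add' _)
  refine ((h1.comp_right A).add (h2.comp_left (cert_lin v))).trans ?_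
  exact Sym.Equiv.rfl.add ((comp_neg_right B _).comp_left (cert_lin v))

/-- `map` through `flatMap` (local copy of the list lemma). [folklore] -/
theorem map_flatMap' {α β γ : Type*} (l : List α) (g : α → List β) (f : β → γ) :
    (l.flatMap g).map f = l.flatMap fun a => (g a).map f := by
  induction l with
  | nil => rfl
  | cons a l ih => simp [List.flatMap_cons, ih]

/-- **The bracket of two fields**: `[X, Y] ≈ bracket X Y`. [folklore] -/
theorem comm_toSym {X Y : Field V} (hX : IsField X) (hcX : CertF X) (hY : IsField Y)
    (hcY : CertF Y) : Sym.comm (toSym X) (toSym Y) ≈ toSym (bracket X Y) := by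
  have hcXs : ∀ s ∈ X.map (fun p => comp p.1 (lin p.2)), Cert s := fun s hs => by
    obtain ⟨p, hp, rfl⟩ := List.mem_map.1 hs; exact ⟨hcX p hp, trivial⟩
  have hcYs : ∀ s ∈ Y.map (fun p => comp p.1 (lin p.2)), Cert s := fun s hs => by
    obtain ⟨p, hp, rfl⟩ := List.mem_map.1 hs; exact ⟨hcY p hp, trivial⟩
  -- both sides are `≈` to the middle form `M`
  let M : Sym V := Sym.sum (X.map fun p => Sym.sum (Y.map fun q =>
    add (comp (comp p.1 (lcomm p.2 q.1)) (lin q.2)) (comp (neg (comp q.1 (lcomm q.2 p.1))) (lin p.2))))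
  have hL : Sym.comm (toSym X) (toSym Y) ≈ M := by
    unfold toSym
    refine (comm_sum_left hcXs (cert_sum hcYs)).trans ?_
    rw [List.map_map]
    refine sum_map_equiv fun p hp => ?_
    refine (comm_sum_right (s := comp p.1 (lin p.2)) ⟨hcX p hp, trivial⟩ hcYs).trans ?_
    rw [List.map_map]
    refine sum_map_equiv fun q hq => ?_
    exact comm_single (hX p hp) (hcX p hp) (hY q hq) (hcY q hq) p.2 q.2
  have hR : toSym (bracket X Y) ≈ M := by
    unfold toSym Field.bracket
    rw [map_flatMap']
    refine (sum_flatMap _ _).trans (sum_map_equiv fun p _ => ?_)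
    rw [map_flatMap']
    refine (sum_flatMap _ _).trans (sum_map_equiv fun q _ => ?_)
    simp only [List.map_cons, List.map_nil]
    exact sum_pair _ _
  exact hL.trans hR.symm

/-! ### The adjoint and the divergence of a field -/

/-- The field with the adjoint coefficients. [folklore] -/
def adjF (X : Field V) : Field V :=
  X.map fun p => (Sym.adj p.1, p.2)

/-- **The divergence** `div X = ∑_k ∂_{v_k} A_k` of a field, a coefficient expression.
[folklore] -/
def divF (X : Field V) : Sym V :=
  Sym.sum (X.map fun p => lcomm p.2 p.1)

omit [InnerProductSpace ℝ V] [FiniteDimensional ℝ V] [MeasurableSpace V] [BorelSpace V] in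
/-- `adjF` of a field is a field. [folklore] -/
theorem IsField.adjF {X : Field V} (h : IsField X) : IsField (adjF X) := fun q hq => by
  obtain ⟨p, hp, rfl⟩ := List.mem_map.1 hq
  exact (h p hp).adjoint

omit [InnerProductSpace ℝ V] [FiniteDimensional ℝ V] in
/-- `adjF` of a certified field is certified. [folklore] -/
theorem CertF.adjF {X : Field V} (h : CertF X) : CertF (adjF X) := fun q hq => by
  obtain ⟨p, hp, rfl⟩ := List.mem_map.1 hq
  exact (h p hp).adjoint

omit [NormedAddCommGroup V] [InnerProductSpace ℝ V] [FiniteDimensional ℝ V] [MeasurableSpace V] [BorelSpace V] in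
/-- A sum of coefficient expressions is a coefficient expression. [folklore] -/
theorem isCoef_sum : ∀ {l : List (Sym V)}, (∀ s ∈ l, IsCoef s) → IsCoef (Sym.sum l)
  | [], _ => isCoef_zero
  | [s], h => h s (List.mem_singleton_self s)
  | s :: t :: l, h => by
    rw [Sym.sum_cons_cons, isCoef_add_iff]
    exact ⟨h s List.mem_cons_self,
      isCoef_sum (l := t :: l) fun u hu => h u (List.mem_cons_of_mem _ hu)⟩

omit [FiniteDimensional ℝ V] [MeasurableSpace V] [BorelSpace V] in
/-- The divergence is a coefficient expression. [folklore] -/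
theorem IsField.isCoef_divF {X : Field V} (h : IsField X) : IsCoef (divF X) :=
  isCoef_sum fun s hs => by
    obtain ⟨p, hp, rfl⟩ := List.mem_map.1 hs
    exact (h p hp).lcomm_isCoef _

omit [FiniteDimensional ℝ V] in
/-- The divergence of a certified field is certified. [folklore] -/
theorem CertF.cert_divF {X : Field V} (hX : IsField X) (h : CertF X) : Cert (divF X) :=
  cert_sum fun s hs => by
    obtain ⟨p, hp, rfl⟩ := List.mem_map.1 hs
    exact (h p hp).lcomm_cert _ (hX p hp)

/-- **The adjoint of a field**: `X† ≈ -(X‡ + div X‡)`, `X‡ = adjF X`. [folklore] -/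
theorem adj_toSym {X : Field V} (hX : IsField X) (hcX : CertF X) :
    Sym.adj (toSym X) ≈ neg (add (toSym (adjF X)) (divF (adjF X))) := by
  -- `adj (sum l) = sum (l.map adj)` syntactically
  have hadj : ∀ l : List (Sym V), Sym.adj (Sym.sum l) = Sym.sum (l.map Sym.adj) := by
    intro l
    induction l with
    | nil => simp [Sym.sum, Sym.zero]
    | cons s l ih =>
      cases l with
      | nil => rfl
      | cons t l => rw [List.map_cons, Sym.sum_cons_cons, Sym.adj_add, ih]; rfl
  unfold toSym
  rw [hadj, List.map_map]
  -- each term: `adj (A lin v) = (-lin v) A† ≈ -(A† lin v + lcomm v A†)`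
  have hterm : ∀ p ∈ X, (Sym.adj ∘ fun p : Sym V × V => comp p.1 (lin p.2)) p ≈
      neg (add (comp (Sym.adj p.1) (lin p.2)) (lcomm p.2 (Sym.adj p.1))) := by
    intro p hp
    simp only [Function.comp_apply, adj_comp, adj_lin]
    exact (comp_neg_left _ _).trans ((hX p hp).adjoint.lin_comp p.2 (hcX p hp).adjoint).neg
  refine (sum_map_equiv hterm).trans ?_
  refine (sum_map_neg X _).trans (Sym.Equiv.neg ?_)
  refine (sum_map_add X _ _).trans (Sym.Equiv.add ?_ ?_)
  · unfold adjF; rw [List.map_map]; exact Sym.Equiv.rfl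
  · unfold divF adjF; rw [List.map_map]; exact Sym.Equiv.rfl

/-! ### Real coefficients and real fields -/

/-- **Real coefficient expressions**: real constants, convolution kernels `θ` with `θ† = θ`
(`θ = 𝓕a`, `a` real), and their real linear combinations and products. [folklore] -/
def _root_.Literature.Analysis.Hypoelliptic.Sym.RealCoef : Sym V → Prop
  | Sym.bessel _ => False
  | Sym.lin _ => False
  | Sym.cmul c => c.im = 0
  | Sym.conv θ => reflConj θ = θ
  | Sym.gcomm1 _ _ => False
  | Sym.gcomm2 _ _ _ => False
  | Sym.smul c s => c.im = 0 ∧ Sym.RealCoef s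
  | Sym.add s t => Sym.RealCoef s ∧ Sym.RealCoef t
  | Sym.comp s t => Sym.RealCoef s ∧ Sym.RealCoef t

omit [InnerProductSpace ℝ V] [FiniteDimensional ℝ V] [MeasurableSpace V] [BorelSpace V] in
/-- Real coefficient expressions are coefficient expressions. [folklore] -/
theorem _root_.Literature.Analysis.Hypoelliptic.Sym.RealCoef.isCoef :
    ∀ {s : Sym V}, Sym.RealCoef s → IsCoef s
  | Sym.bessel _, h => h.elim
  | Sym.lin _, h => h.elim
  | Sym.cmul _, _ => trivial
  | Sym.conv _, _ => trivial
  | Sym.gcomm1 _ _, h => h.elim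
  | Sym.gcomm2 _ _ _, h => h.elim
  | Sym.smul _ s, ⟨_, hs⟩ => Sym.RealCoef.isCoef (s := s) hs
  | Sym.add _ _, ⟨hs, ht⟩ => ⟨Sym.RealCoef.isCoef hs, Sym.RealCoef.isCoef ht⟩
  | Sym.comp _ _, ⟨hs, ht⟩ => ⟨Sym.RealCoef.isCoef hs, Sym.RealCoef.isCoef ht⟩

/-- Commuting coefficient expressions: `comp t s ≈ comp s t`. [folklore] -/
theorem _root_.Literature.Analysis.Hypoelliptic.Sym.IsCoef.comp_comm_equiv {s t : Sym V}
    (hs : IsCoef s) (hcs : Cert s) (ht : IsCoef t) (hct : Cert t) : comp t s ≈ comp s t := by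
  intro F hF
  have h := ht.comm_coef hct hs hcs F hF
  simp only [apply_comm, apply_zero] at h
  ext ξ
  have hξ := congrFun h ξ
  simp only [apply_comp] at hξ ⊢
  linear_combination hξ

/-- **A real coefficient expression is self-adjoint up to `≈`**: `adj A ≈ A`. [folklore] -/
theorem _root_.Literature.Analysis.Hypoelliptic.Sym.RealCoef.adj_equiv :
    ∀ {s : Sym V}, Sym.RealCoef s → Cert s → Sym.adj s ≈ s
  | Sym.bessel _, h, _ => h.elim
  | Sym.lin _, h, _ => h.elim
  | Sym.cmul c, h, _ => by
    rw [Sym.adj_cmul, (Complex.conj_eq_iff_im).2 h]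
    exact Sym.Equiv.rfl
  | Sym.conv θ, h, _ => by
    rw [Sym.adj_conv, h]
    exact Sym.Equiv.rfl
  | Sym.gcomm1 _ _, h, _ => h.elim
  | Sym.gcomm2 _ _ _, h, _ => h.elim
  | Sym.smul c s, ⟨hc, hs⟩, hcs => by
    rw [Sym.adj_smul, (Complex.conj_eq_iff_im).2 hc]
    exact (Sym.RealCoef.adj_equiv (s := s) hs hcs).smul c
  | Sym.add _ _, ⟨hs, ht⟩, ⟨hcs, hct⟩ =>
    (Sym.RealCoef.adj_equiv hs hcs).add (Sym.RealCoef.adj_equiv ht hct)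
  | Sym.comp s t, ⟨hs, ht⟩, ⟨hcs, hct⟩ => by
    rw [Sym.adj_comp]
    exact ((Sym.RealCoef.adj_equiv ht hct).comp (Sym.RealCoef.adj_equiv hs hcs) hcs.adjoint).trans
      (hs.isCoef.comp_comm_equiv hcs ht.isCoef hct)

omit [MeasurableSpace V] [BorelSpace V] [FiniteDimensional ℝ V] in
/-- `(2πi⟪·,v⟫ θ)† = 2πi⟪·,v⟫ θ` when `θ† = θ`. [folklore] -/
theorem reflConj_linMul_mul {θ : V → ℂ} (h : reflConj θ = θ) (v : V) :
    reflConj (fun ζ => linMul v ζ * θ ζ) = fun ζ => linMul v ζ * θ ζ := by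
  ext ζ
  have hθ := congrFun h ζ
  simp only [reflConj] at hθ ⊢
  rw [map_mul, hθ, show linMul v (-ζ) = -linMul v ζ by simp [linMul_apply, inner_neg_left],
    map_neg, Sym.conj_linMul, neg_neg]

omit [FiniteDimensional ℝ V] [MeasurableSpace V] [BorelSpace V] in
/-- `lcomm` preserves real coefficient expressions. [folklore] -/
theorem _root_.Literature.Analysis.Hypoelliptic.Sym.RealCoef.lcomm (v : V) :
    ∀ {s : Sym V}, Sym.RealCoef s → Sym.RealCoef (lcomm v s)
  | Sym.bessel _, h => h.elim
  | Sym.lin _, h => h.elim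
  | Sym.cmul _, _ => by simp [Sym.lcomm, Sym.zero, Sym.RealCoef]
  | Sym.conv _, h => reflConj_linMul_mul h v
  | Sym.gcomm1 _ _, h => h.elim
  | Sym.gcomm2 _ _ _, h => h.elim
  | Sym.smul _ s, ⟨hc, hs⟩ => ⟨hc, Sym.RealCoef.lcomm v (s := s) hs⟩
  | Sym.add _ _, ⟨hs, ht⟩ => ⟨Sym.RealCoef.lcomm v hs, Sym.RealCoef.lcomm v ht⟩
  | Sym.comp _ _, ⟨hs, ht⟩ =>
    ⟨⟨Sym.RealCoef.lcomm v hs, ht⟩, hs, Sym.RealCoef.lcomm v ht⟩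

/-- **Real fields**: all coefficients are real coefficient expressions. [folklore] -/
def IsReal (X : Field V) : Prop := ∀ p ∈ X, Sym.RealCoef p.1

omit [FiniteDimensional ℝ V] [MeasurableSpace V] [BorelSpace V] in
/-- The bracket of real fields is real. [folklore] -/
theorem IsReal.bracket {X Y : Field V} (hX : IsReal X) (hY : IsReal Y) : IsReal (bracket X Y) := by
  intro r hr
  simp only [Field.bracket, List.mem_flatMap, List.mem_cons, List.mem_nil_iff, or_false] at hr
  obtain ⟨p, hp, q, hq, rfl | rfl⟩ := hr
  · exact ⟨hX p hp, (hY q hq).lcomm _⟩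
  · exact ⟨by simp, hY q hq, (hX p hp).lcomm _⟩

/-- For a real field, `toSym (adjF X) ≈ toSym X`. [folklore] -/
theorem IsReal.toSym_adjF {X : Field V} (hr : IsReal X) (hcX : CertF X) :
    toSym (adjF X) ≈ toSym X := by
  unfold toSym adjF
  rw [List.map_map]
  exact sum_map_equiv fun p hp => ((hr p hp).adj_equiv (hcX p hp)).comp_left (cert_lin _)

/-- For a real field, `divF (adjF X) ≈ divF X`. [folklore] -/
theorem IsReal.divF_adjF {X : Field V} (hX : IsField X) (hr : IsReal X) (hcX : CertF X) :
    divF (adjF X) ≈ divF X := by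
  unfold divF adjF
  rw [List.map_map]
  refine sum_map_equiv fun p hp => ?_
  have hA := hX p hp
  have hc := hcX p hp
  -- `lcomm v A† ≈ [lin v, A†] ≈ [lin v, A] ≈ lcomm v A`
  exact ((hA.adjoint.comm_lin p.2 hc.adjoint).symm.trans
    (Sym.Equiv.rfl.comm ((hr p hp).adj_equiv hc) (cert_lin _) hc.adjoint)).trans
    (hA.comm_lin p.2 hc)

/-- **The adjoint of a real field**: `X† ≈ -(X + div X)` (integration by parts,
`X* = -X - div X`). [folklore] -/
theorem IsReal.adj_toSym {X : Field V} (hX : IsField X) (hcX : CertF X) (hr : IsReal X) :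
    Sym.adj (toSym X) ≈ neg (add (toSym X) (divF X)) :=
  (Field.adj_toSym hX hcX).trans ((hr.toSym_adjF hcX).add (hr.divF_adjF hX hcX)).neg

end Field

end Literature.Analysis.Hypoelliptic
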